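import Summits.HodgeConjecture.HodgeConjecture.Theses.MilnorKExponential
import Literature.AlgebraicGeometry.HodgeTheory.ComplexGysin
import Literature.AlgebraicGeometry.HodgeTheory.ComplexConjugationHolds
import Literature.AlgebraicGeometry.Motives.VarietiesProjectiveSpaceProofs
import Summits.HodgeConjecture.HodgeConjecture.Theorems.MilnorKExponentialSymbolLiftRKernel

/-!
# Disproof of `SymbolLiftR` (stmt-HodgeConjecture-18702) — standing disprover's work file

Crux `MilnorKExponential.SymbolLiftR` (route MilnorKExponential, rank 3): LIFT_p for
`1 ≤ p = q + 1 ≤ n = dim X` — every rational `(q+1,q+1)` class on a smooth projective complex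
`n`-fold is a SYMBOL CLASS of weight `q+1` (inlined `IsSymbolClass`: `∃` Hodge model `A` with
(N) a NORMALISATION clause — some holomorphic line bundle `L` on `A.carrier` whose `(q+1)`-fold
`dlog`-power Čech cocycle transgresses (Čech–de Rham zigzag `Tr`) to a closed form whose class, read
through `A.deRham`, is a NON-ZERO RATIONAL class `c₀` — and (S) a SYMBOL clause — a finite open
cover, a Čech `(q+1)`-cocycle `σ` of good Milnor-symbol chains modulo the naive Milnor relations,
transgressing to `θ` with `A.deRham [θ] = m • A^* c`, `m ≠ 0`).

VERDICT (cycle 1, refuter-cdisprove-stmt-HodgeConjecture-18702-0, 2026-08-17): NO KILL; the crux is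
HC-hard to refute (§2) and honestly typed (read-back below); one load-bearing hypothesis is formally
tight (§4); the cheapest remaining falsifier is isolated (§3) and is a typing test, true on paper.

VERDICT (gen 2, cycle 1, refuter-cdisprove-stmt-HodgeConjecture-18702-g2-0, 2026-08-17): NO KILL.
§1–§5 are landed verbatim as `Theorems/SymbolLiftR/Negative/LoadBearing.lean` (p154015); the §3
typing falsifier is SETTLED POSITIVELY by the line (`Theorems.SymbolLiftR.normalisedModelsExist`,
p153687: (N) is satisfiable in every weight `q + 1 ≤ n`).  New this cycle: §7 attacks the line
`lefschetz-fold` and its one open stub S5∃ `stub_primitiveLiftExists` (hypothesis mutation: both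
arithmetic guards IDLE, `m ≠ 0` load-bearing as non-vacuity, rationality / Hodge type load-bearing on
paper, joint sufficiency re-certified, surplus over the crux = model transport exactly); §8 shows the
multiplier `m` has NO content at crux level (`SymbolLiftR ↔ SymbolLiftROne`).  Why it resists: by §2
every kill is a counterexample to HC (given Alg ⊆ L), the first honest case being a primitive rational
`(2,2)` class outside the divisor algebra on a fourfold (`S × S'` with `p_g ≥ 1`, HK/CY fourfolds);
the abelian-fourfold sector carries certified POSITIVE numerics (AH2-REPORT.md, kit j025690/j025754);
no printed negative exists (literature, NOTES §lit); and every natural weakening that IS false on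
paper (drop rationality, drop Hodge type, `∀ A`) needs the one typing fact the tree lacks —
integrality of `c₁` of an ARBITRARY holomorphic cocycle on an arbitrary finite cover.

FINDINGS, by section:

* §1 `symbolLiftR_iff` — the crux restated through the two named clauses `NormClause A q`,
  `SymbClause A q c` (`Iff.rfl`): every lemma below is about the crux exactly as filed.
* §2 CEILING `not_hodgeConjecture_of_not_symbolLiftR` — given the support item
  `AlgebraicClassesAreSymbolClasses` (Alg ⊆ L, 2001 Thm A), `HodgeConjecture → SymbolLiftR`; so a
  class witnessing `¬ SymbolLiftR` is a rational `(p,p)` class that is NOT algebraic: every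
  refutation of this crux is a counterexample to the Hodge conjecture or a refutation of the TYPING
  item Alg ⊆ L (stmt-HodgeConjecture-18703).  No small / degenerate model can kill it inside
  `q + 1 ≤ n`; for `q = 0` (Lefschetz (1,1)) and `n ≤ 3` not even in principle.
* §3 THE `c = 0` PROBE (`symbClause_zero`, `exists_normClause_of_symbolLiftR`,
  `symbolLiftR_zero_iff_normClause`) — at the zero class the symbol clause is free (zero cochain on
  the one-set cover `{univ}`, zigzag `Z = 0`), so SymbolLiftR at `c = 0` is EXACTLY the
  satisfiability of (N): `SymbolLiftR → ∀ X smooth projective, ∀ q < n, ∃ A, NormClause A q`.  This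
  is the cheapest falsifier left (refuter R3's "ℙ¹, p = 1, c = h" test is this statement at
  `n = 1, q = 0`), a pure TYPING test of `Tr` / `HolomorphicLineBundle` / `A.deRham`.  On paper it
  HOLDS: `L = O(1)` on `ℙⁿ` with its standard `(n+1)`-chart cocycle `g_ij = x_j/x_i`, `Z(0,1)_i = -A_i`
  (connection forms, smooth on `U_i`, extended by zero — allowed by `smoothFormsOn`), `θ₀ = dZ`
  (minus the curvature), `[θ₀] = 2πi c₁(L)` under integration, made rational by the model
  `rescale A (2πi)⁻¹` (§5); for `q ≥ 1` the cup-power cocycle and the full zigzag.  Not decidable in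
  the tree today either way (no `H²(ℙ¹(ℂ); ℂ) = ℂ·h`, no period integrality, no de Rham class of a
  curvature form).
* §3b `m ≠ 0` IS LOAD-BEARING IN (S): `symbClauseAnyMultiple_trivial` — with `m ≠ 0` dropped the
  symbol clause holds for EVERY class (zero cochain, `m = 0`); the crux would collapse to (N).
* §4 LOAD-BEARING `q + 1 ≤ n`, TIGHT: `not_subsingleton_of_normClause` ((N) forces
  `H^{2q+2}(X(ℂ); ℂ) ≠ 0`) and `symbolLiftR_false_without_dimBound` — with the bound weakened
  by ONE (`q ≤ n`) the statement is false (witness `X = ℙ⁰`, `n = q = 0`, `c = 0`: (N) wants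
  `c₀ ≠ 0` in `H²(pt) = 0`, `subsingleton_complexBetti`).  This re-files the refutation of the first
  filing `SymbolLift` (stmt-17744, `MilnorKExponentialSymbolLift_refuted`) against the live decl's
  exact clauses: any proof must use `q + 1 ≤ n` on the nose (it is used to make (N) satisfiable, not
  only to make `c` interesting).
* §5 WHY `(2πi)^{q+1}` IS NOT AN OBSTRUCTION: `rescale`, `rescale_deRham_apply`,
  `normClause_rescale` — the `∃ A` ranges over de Rham comparison families up to a scalar
  `s ∈ ℂˣ` (`rescale A s` is again a Hodge model: naturality is linear, the Hodge-decomposition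
  field does not see the comparison); (N) pins `s` to `(2πi)^{-(q+1)} ℚˣ` and is stable EXACTLY
  under `ℚˣ`.  My first attack — "(N) is unsatisfiable because `2πi · c₁(L)` is irrational, so the
  crux dies at `c = 0` on ℙ¹" — is therefore WRONG for the statement as typed; provers must pick the
  rescaled model, not the integration one.
* §6 NEAR-MISSES (sorried; docstrings carry witness + obstruction): dropping `IsRationalClass`
  (witness `i • h` on ℙ¹), `∀ A` for `∃ A` (witness `rescale A π`).  Also false on paper but not even
  stated: dropping projectivity (`𝔸¹`, `H² = 0`: no Hodge model of a non-proper scheme in the tree),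
  dropping `IsOfHodgeType` (abelian surface, `q = 0`: rational classes outside `NS ⊗ ℚ`; no period
  computation), `m = 1` (integral LIFT: `h/2` on ℙ¹).
* §7 LINE `lefschetz-fold` — THE OPEN STUB S5∃ (`PrimitiveLiftExists`, verbatim the registered
  `stub_primitiveLiftExists`, reshape r2): §7.1 `symbolLiftR_of_primitiveLiftExists` — joint
  sufficiency is the landed reduction (p156948), no gap; §7.2 `primitiveLiftExistsNoDimGuard_iff` —
  the guard `4 ≤ n` is IDLE (equivalent statement without it: the `∃ Λ ∃ A` shell is a theorem in
  every dimension); §7.3 `primitiveLiftExistsNoDegreeGuard_iff` — the guard `2(q+2) ≤ n` is IDLE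
  (primitivity self-guards: `j = 0` forces `c = L⁰ c = 0`, zero cocycle); §7.4
  `hasSymbolCocycleAnyMultiple_trivial` — `m ≠ 0` in the stub is load-bearing as non-vacuity only;
  §7.5 near-misses `primitiveLiftExists_false_without_rational` (`ℙ² × ℙ²`, `√2 • π`) and
  `…_without_hodgeType` (abelian fourfold, rational primitive class with `(4,0)`-part) — false on
  paper, sorried, obstruction = integrality of `c₁` of an arbitrary cocycle / no `X` with computed
  `h^{4,0}`; §7.6 `primitiveLiftExists_of_symbolLiftR` — `ModelTransport → SymbolLiftR → S5∃`: the
  stub is the crux (restricted to primitive classes) PLUS one-model transport, a typing surplus and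
  nothing mathematical (primitivity is not even used in this direction).
* §8 `symbolLiftR_iff_symbolLiftROne` — the multiplier can be normalised to `m = 1` by the rational
  rescale `m⁻¹` of the model ((N) tolerates `ℚˣ`, §5): with §3b, only `m ≠ 0` vs `m = 0` matters; the
  crux has no integral content, so torsion / non-divisibility phenomena (Atiyah–Hirzebruch, Kollár)
  cannot be turned against it.  (The §6 remark "`m = 1` false on paper (`h/2` on ℙ¹)" holds on a FIXED
  integration-scaled model only, i.e. for the line's one-model statements in weight one.)

READ-BACK OF THE TYPING (step 2; all REAL definitions, no placeholder `Prop` fields):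
`MForm I M ℂ k = Π_x T_xM [⋀^Fin k]→L[ℝ] ℂ` (unbundled); `wedge` = `(k!l!)⁻¹ Σ_σ sign σ …`
(`constOfIsEmpty_one_wedge`: `1 ∧ β = β`, so `DW t = dlog t₀ ∧ ⋯ ∧ dlog t_q` honestly);
`mextDeriv` chart-wise `extDerivWithin` (local: germ-determined); `CechForms U a b = Π_J
smoothFormsOn (cechSet U J) b` — forms smooth AT the points of `U_J` and ZERO off `U_J` (so the
global equation (ii) of `Tr` is the honest one on `U_J`; discontinuity at `∂U_J` is allowed, which is
what makes connection forms admissible); `cechδ = Σ_j (-1)^j restr` (Bott–Tu (8.4)),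
`cechd = (-1)^a d` (Weibel sign; signs never affect solvability); `Tr` = the standard zigzag
`δZ(q,q+1) = w`, `dZ(a+1,b) = ±δZ(a,b+1)`, `dZ(0,2q+1) = θ|U_i` — solvable for every `δ`- and
`d`-closed `w` smooth on the `U_J` by `cechDeRham_rowExact` (partition of unity, finite `ι`,
cover of the carrier), and `w = SF ∘ σ` IS such: `SF` kills the three relation families pointwise on
the OPEN set `U_J` (tuples agreeing on `U_J` have equal germs there; Leibniz for `mextDeriv` of a
product of `MDifferentiable` functions; `dlog f ∧ dlog(1-f) = 0`), so the cocycle-mod-`Rel` condition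
gives `δw = 0` on `U_{J'}`; `HolomorphicLineBundle` carries cover + holomorphic non-vanishing
`g_ij` + cocycle condition (no empty-cover junk); `HodgeModel` = analytification (unique up to
biholomorphism) + natural de Rham family (unique up to `ℂˣ` per degree, §5) + Hodge decomposition;
`IsOfHodgeType` is model-independent.  Junk models of `X` (no Hodge model) make `IsOfHodgeType`
false, hence the crux vacuously true there — no refutation from the scheme side.  Hence
SymbolLiftR ≡ LIFT_{q+1} for Čech cohomology of the NAIVE Milnor presheaf on finite covers of the
compact `X^an`, which equals that of its sheafification (Godement: presheaves with zero
sheafification are Čech-acyclic on paracompact spaces), i.e. the 2001 LIFT_p; first open case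
`(n,p) = (4,2)`, same as HC.

LITERATURE (negatives searched): see NOTES.md §lit; nothing in print asserts `∂_p(Hdg) ≠ 0` for any
class; the nearest printed negatives (Kollár: INTEGRAL GK₂ false; Voisin 2002 Weil tori: no coherent
`c₂`) are evaded by `m ≠ 0` and by symbol cocycles not being coherent sheaves (route Barriers §).
-/

noncomputable section

-- The mandated namespace repeats `HodgeConjecture` (single-conjunct summit).
set_option linter.dupNamespace false

namespace Summit.HodgeConjecture.HodgeConjecture.Cruxes.SymbolLiftR.Disproof

open scoped Manifold
open Literature.AlgebraicGeometry.HodgeTheory Literature.AlgebraicGeometry.Motives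
open Summit.HodgeConjecture.HodgeConjecture.Theses.MilnorKExponential

variable {n : ℕ} {X : SchemeOver ℂ}

/-! ### §1 The two clauses of the inlined `IsSymbolClass`, named -/

/-- **(N) the normalisation clause** of the inlined `IsSymbolClass` of `SymbolLiftR`, for a FIXED
Hodge model `A` and weight `q + 1` (verbatim the route text): some holomorphic line bundle `L` on
`A.carrier` (finite index type) whose `(q+1)`-fold `dlog`-power Čech cocycle transgresses to a closed
`(2q+2)`-form `θ₀` with `A.deRham [θ₀] = A^* c₀`, `c₀` rational and non-zero. [folklore] -/
def NormClause (A : HodgeModel n X) (q : ℕ) : Prop :=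
  let F : ℕ → Type := fun k ↦ Literature.Geometry.Kaehler.MForm 𝓘(ℝ, A.model) A.carrier ℂ k; let CF := Literature.NumberTheory.Transcendental.cclosedSmoothForms A.model A.carrier (2 * q + 1 + 1); let MK := Literature.NumberTheory.Transcendental.complexDeRhamCohomology.mk A.model A.carrier (2 * q + 1 + 1); let DR := A.deRham A.carrier (2 * q + 1 + 1); let T : Type := Fin (q + 1) → (A.carrier → ℂ); let DW : T → F (q + 1) := fun t ↦ Fin.hIterate (fun k : ℕ ↦ F k) (Literature.Geometry.Kaehler.MForm.ofFun 𝓘(ℝ, A.model) (fun _ : A.carrier ↦ (1 : ℂ))) (fun (i : Fin (q + 1)) (acc : F (i : ℕ)) ↦ Literature.Geometry.Kaehler.MForm.wedge acc (fun x : A.carrier ↦ (t i x)⁻¹ • Literature.Geometry.Kaehler.mextDeriv (Literature.Geometry.Kaehler.MForm.ofFun 𝓘(ℝ, A.model) (t i)) x)); let SF : (T →₀ ℤ) → F (q + 1) := fun σ ↦ Finsupp.sum σ fun (t : T) (z : ℤ) ↦ z • DW t; let Tr : (ι : Type) → (U : ι → Set A.carrier) → (∀ i, IsOpen (U i)) →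 ((Fin (q + 2) → ι) → F (q + 1)) → F (2 * q + 1 + 1) → Prop := fun ι U hU w θ ↦ ∃ Z : (a b : ℕ) → Literature.Geometry.Kaehler.CechForms 𝓘(ℝ, A.model) ℂ U a b, (∀ (J : Fin (q + 2) → ι), ∀ x ∈ Literature.Geometry.Kaehler.cechSet U J, ((Literature.Geometry.Kaehler.cechδ 𝓘(ℝ, A.model) ℂ hU q (q + 1) (Z q (q + 1)) J : F (q + 1)) x = w J x)) ∧ (∀ a b : ℕ, a + 1 + b = 2 * q + 1 → a < q → Literature.Geometry.Kaehler.cechd 𝓘(ℝ, A.model) ℂ hU (a + 1) b (Z (a + 1) b) = Literature.Geometry.Kaehler.cechδ 𝓘(ℝ, A.model) ℂ hU a (b + 1) (Z a (b + 1))) ∧ (∀ (J : Fin 1 → ι), ∀ x ∈ Literature.Geometry.Kaehler.cechSet U J, ((Literature.Geometry.Kaehler.cechd 𝓘(ℝ, A.model) ℂ hU 0 (2 * q + 1) (Z 0 (2 * q + 1)) J : F (2 * q + 1 + 1)) x = θ x)); (∃ (ι : Type) (_ : Fintype ι) (L : Literature.Geometry.Kaehler.HolomorphicLineBundle ι A.model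 A.carrier) (θ₀ : CF) (c₀ : Literature.AlgebraicGeometry.HodgeTheory.complexBetti X (2 * q + 1 + 1)), Tr ι L.baseSet L.isOpen_baseSet (fun J ↦ SF (Finsupp.single (fun i : Fin (q + 1) ↦ L.coordChange (J (Fin.castSucc i)) (J i.succ)) 1)) θ₀ ∧ Literature.AlgebraicGeometry.HodgeTheory.IsRationalClass c₀ ∧ c₀ ≠ 0 ∧ DR (MK θ₀) = A.pullback (2 * q + 1 + 1) c₀)

/-- **(S) the symbol clause** of the inlined `IsSymbolClass` of `SymbolLiftR`, for a FIXED Hodge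
model `A`, weight `q + 1` and class `c` (verbatim the route text): a finite open cover, a Čech
`(q+1)`-cochain `σ` of good Milnor-symbol chains, cocycle modulo the naive Milnor relations,
transgressing to `θ` with `A.deRham [θ] = m • A^* c`, `m ≠ 0`. [folklore] -/
def SymbClause (A : HodgeModel n X) (q : ℕ) (c : complexBetti X (2 * (q + 1))) : Prop :=
  let F : ℕ → Type := fun k ↦ Literature.Geometry.Kaehler.MForm 𝓘(ℝ, A.model) A.carrier ℂ k; let CF := Literature.NumberTheory.Transcendental.cclosedSmoothForms A.model A.carrier (2 * q + 1 + 1); let MK := Literature.NumberTheory.Transcendental.complexDeRhamCohomology.mk A.model A.carrier (2 * q + 1 + 1); let DR := A.deRham A.carrier (2 * q + 1 + 1); let T : Type := Fin (q + 1) → (A.carrier → ℂ); let IsU : Set A.carrier → (A.carrier → ℂ) → Prop := fun W f ↦ MDifferentiableOn 𝓘(ℂ, A.model) 𝓘(ℂ, ℂ) f W ∧ ∀ x ∈ W, f x ≠ 0; let Good : Set A.carrier → T → Prop := fun W t ↦ ∀ i, IsU W (t i); let Rel : Set A.carrier → AddSubgroup (T →₀ ℤ) := fun W ↦ AddSubgroup.closure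 ({s : T →₀ ℤ | ∃ t t' : T, Good W t ∧ Good W t' ∧ (∀ i, ∀ x ∈ W, t i x = t' i x) ∧ s = Finsupp.single t 1 - Finsupp.single t' 1} ∪ {s : T →₀ ℤ | ∃ (t : T) (i : Fin (q + 1)) (g : A.carrier → ℂ), Good W t ∧ IsU W g ∧ s = Finsupp.single (Function.update t i (t i * g)) 1 - Finsupp.single t 1 - Finsupp.single (Function.update t i g) 1} ∪ {s : T →₀ ℤ | ∃ (t : T) (i j : Fin (q + 1)), Good W t ∧ i ≠ j ∧ (∀ x ∈ W, t i x + t j x = 1) ∧ s = Finsupp.single t 1}); let DW : T → F (q + 1) := fun t ↦ Fin.hIterate (fun k : ℕ ↦ F k) (Literature.Geometry.Kaehler.MForm.ofFun 𝓘(ℝ, A.model) (fun _ : A.carrier ↦ (1 : ℂ))) (fun (i : Fin (q + 1)) (acc : F (i : ℕ)) ↦ Literature.Geometry.Kaehler.MForm.wedge acc (fun x : A.carrier ↦ (t i x)⁻¹ • Literature.Geometry.Kaehler.mextDeriv (Literature.Geometry.Kaehler.MForm.ofFun 𝓘(ℝ, A.model) (t i)) x)); let SF : (T →₀ ℤ)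 → F (q + 1) := fun σ ↦ Finsupp.sum σ fun (t : T) (z : ℤ) ↦ z • DW t; let Tr : (ι : Type) → (U : ι → Set A.carrier) → (∀ i, IsOpen (U i)) → ((Fin (q + 2) → ι) → F (q + 1)) → F (2 * q + 1 + 1) → Prop := fun ι U hU w θ ↦ ∃ Z : (a b : ℕ) → Literature.Geometry.Kaehler.CechForms 𝓘(ℝ, A.model) ℂ U a b, (∀ (J : Fin (q + 2) → ι), ∀ x ∈ Literature.Geometry.Kaehler.cechSet U J, ((Literature.Geometry.Kaehler.cechδ 𝓘(ℝ, A.model) ℂ hU q (q + 1) (Z q (q + 1)) J : F (q + 1)) x = w J x)) ∧ (∀ a b : ℕ, a + 1 + b = 2 * q + 1 → a < q → Literature.Geometry.Kaehler.cechd 𝓘(ℝ, A.model) ℂ hU (a + 1) b (Z (a + 1) b) = Literature.Geometry.Kaehler.cechδ 𝓘(ℝ, A.model) ℂ hU a (b + 1) (Z a (b + 1))) ∧ (∀ (J : Fin 1 → ι), ∀ x ∈ Literature.Geometry.Kaehler.cechSet U J, ((Literature.Geometry.Kaehler.cechd 𝓘(ℝ, A.model) ℂ hU 0 (2 * q + 1)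 (Z 0 (2 * q + 1)) J : F (2 * q + 1 + 1)) x = θ x)); (∃ (ι : Type) (_ : Fintype ι) (U : ι → Set A.carrier) (hU : ∀ i, IsOpen (U i)) (_ : ∀ x, ∃ i, x ∈ U i) (σ : (Fin (q + 2) → ι) → (T →₀ ℤ)) (_ : ∀ J, ∀ t ∈ (σ J).support, Good (Literature.Geometry.Kaehler.cechSet U J) t) (_ : ∀ J' : Fin (q + 3) → ι, (∑ j : Fin (q + 3), ((-1 : ℤ) ^ (j : ℕ)) • σ (J' ∘ Fin.succAbove j)) ∈ Rel (Literature.Geometry.Kaehler.cechSet U J')) (θ : CF) (m : ℤ), m ≠ 0 ∧ Tr ι U hU (fun J ↦ SF (σ J)) θ ∧ DR (MK θ) = (m : ℂ) • A.pullback (2 * q + 1 + 1) c)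

/-- `SymbolLiftR` is, definitionally, "rational `(q+1,q+1)` classes with `q + 1 ≤ n` satisfy
(N) ∧ (S) in some Hodge model". [folklore] -/
theorem symbolLiftR_iff :
    SymbolLiftR ↔ ∀ ⦃n : ℕ⦄ ⦃X : SchemeOver ℂ⦄, IsSmoothProjective n X → ∀ (q : ℕ), q + 1 ≤ n →
      ∀ (c : complexBetti X (2 * (q + 1))), IsRationalClass c →
        IsOfHodgeType n X (2 * (q + 1)) (q + 1) (q + 1) c →
          ∃ A : HodgeModel n X, NormClause A q ∧ SymbClause A q c :=
  Iff.rfl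

/-! ### §2 Ceiling: under Alg ⊆ L the crux is implied by the Hodge conjecture -/

/-- The support item `AlgebraicClassesAreSymbolClasses` (Alg ⊆ L) has, definitionally, the SAME two
clauses as conclusion: "rational algebraic classes of codimension `q + 1 ≤ n` satisfy (N) ∧ (S) in some
Hodge model" — which is what makes the ceiling below a one-liner. [folklore] -/
theorem algebraicClassesAreSymbolClasses_iff :
    AlgebraicClassesAreSymbolClasses ↔ ∀ ⦃n : ℕ⦄ ⦃X : SchemeOver ℂ⦄, IsSmoothProjective n X →
      ∀ (q : ℕ), q + 1 ≤ n → ∀ (c : complexBetti X (2 * (q + 1))), IsRationalClass c →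
        c ∈ algebraicClasses X (q + 1) → ∃ A : HodgeModel n X, NormClause A q ∧ SymbClause A q c :=
  Iff.rfl

/-- **CEILING: `¬ SymbolLiftR → (Alg ⊆ L) → ¬ HodgeConjecture`.** Under the Hodge conjecture a
rational `(q+1,q+1)` class is algebraic, and the support item `AlgebraicClassesAreSymbolClasses`
(Alg ⊆ L: 2001 Thm A, Bloch–Quillen–Kerz + the `dlog` fundamental class) makes it a symbol class —
verbatim the conclusion of `SymbolLiftR`.  So every refutation of this crux is a non-algebraic Hodge
class (a counterexample to the summit) unless the typing item Alg ⊆ L is itself refuted; in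
particular no degenerate / small-model kill exists inside `q + 1 ≤ n`. [folklore] -/
theorem not_hodgeConjecture_of_not_symbolLiftR (h : ¬ SymbolLiftR)
    (hAlg : AlgebraicClassesAreSymbolClasses) : ¬ _root_.HodgeConjecture :=
  fun hHC ↦ h fun _n _X hX q hq c hc hpp ↦ hAlg hX q hq c hc ((hHC hX).2 (q + 1) c hc hpp)

/-! ### §3 The `c = 0` probe: at the zero class the crux is exactly the normalisation clause -/

/-- **(S) holds for `c = 0` in every Hodge model**: the zero symbol cochain on the one-set cover
`{univ}`, zigzag `Z = 0`, `θ = 0`, `m = 1`. [folklore] -/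
theorem symbClause_zero (A : HodgeModel n X) (q : ℕ) : SymbClause A q 0 := by
  dsimp only [SymbClause]
  refine ⟨Unit, inferInstance, fun _ ↦ Set.univ, fun _ ↦ isOpen_univ, fun x ↦ ⟨(), Set.mem_univ x⟩,
    fun _ ↦ 0, ?_, ?_, 0, 1, one_ne_zero, ⟨fun _ _ ↦ 0, ?_, ?_, ?_⟩, ?_⟩
  · intro J t ht
    simp at ht
  · intro J'
    simp only [smul_zero, Finset.sum_const_zero]
    exact zero_mem _
  · intro J x _
    simp
  · intro a b _ _
    simp only [map_zero]
  · intro J x _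
    simp
  · simp

/-- (S) with the side condition `m ≠ 0` DROPPED (everything else verbatim). [folklore] -/
def SymbClauseAnyMultiple (A : HodgeModel n X) (q : ℕ) (c : complexBetti X (2 * (q + 1))) : Prop :=
  let F : ℕ → Type := fun k ↦ Literature.Geometry.Kaehler.MForm 𝓘(ℝ, A.model) A.carrier ℂ k; let CF := Literature.NumberTheory.Transcendental.cclosedSmoothForms A.model A.carrier (2 * q + 1 + 1); let MK := Literature.NumberTheory.Transcendental.complexDeRhamCohomology.mk A.model A.carrier (2 * q + 1 + 1); let DR := A.deRham A.carrier (2 * q + 1 + 1); let T : Type := Fin (q + 1) → (A.carrier → ℂ); let IsU : Set A.carrier → (A.carrier → ℂ) → Prop := fun W f ↦ MDifferentiableOn 𝓘(ℂ, A.model) 𝓘(ℂ, ℂ) f W ∧ ∀ x ∈ W, f x ≠ 0; let Good : Set A.carrier → T → Prop := fun W t ↦ ∀ i, IsU W (t i); let Rel : Set A.carrier → AddSubgroup (T →₀ ℤ) := fun W ↦ AddSubgroup.closure ({s : T →₀ ℤ | ∃ t t' : T, Good W t ∧ Good W t' ∧ (∀ i, ∀ x ∈ W, t i x = t' i x) ∧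 s = Finsupp.single t 1 - Finsupp.single t' 1} ∪ {s : T →₀ ℤ | ∃ (t : T) (i : Fin (q + 1)) (g : A.carrier → ℂ), Good W t ∧ IsU W g ∧ s = Finsupp.single (Function.update t i (t i * g)) 1 - Finsupp.single t 1 - Finsupp.single (Function.update t i g) 1} ∪ {s : T →₀ ℤ | ∃ (t : T) (i j : Fin (q + 1)), Good W t ∧ i ≠ j ∧ (∀ x ∈ W, t i x + t j x = 1) ∧ s = Finsupp.single t 1}); let DW : T → F (q + 1) := fun t ↦ Fin.hIterate (fun k : ℕ ↦ F k) (Literature.Geometry.Kaehler.MForm.ofFun 𝓘(ℝ, A.model) (fun _ : A.carrier ↦ (1 : ℂ))) (fun (i : Fin (q + 1)) (acc : F (i : ℕ)) ↦ Literature.Geometry.Kaehler.MForm.wedge acc (fun x : A.carrier ↦ (t i x)⁻¹ • Literature.Geometry.Kaehler.mextDeriv (Literature.Geometry.Kaehler.MForm.ofFun 𝓘(ℝ, A.model) (t i)) x)); let SF : (T →₀ ℤ) → F (q + 1) := fun σ ↦ Finsupp.sum σ fun (t : T) (z : ℤ) ↦ z • DW t; let Tr : (ι : Type) → (U : ι →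 Set A.carrier) → (∀ i, IsOpen (U i)) → ((Fin (q + 2) → ι) → F (q + 1)) → F (2 * q + 1 + 1) → Prop := fun ι U hU w θ ↦ ∃ Z : (a b : ℕ) → Literature.Geometry.Kaehler.CechForms 𝓘(ℝ, A.model) ℂ U a b, (∀ (J : Fin (q + 2) → ι), ∀ x ∈ Literature.Geometry.Kaehler.cechSet U J, ((Literature.Geometry.Kaehler.cechδ 𝓘(ℝ, A.model) ℂ hU q (q + 1) (Z q (q + 1)) J : F (q + 1)) x = w J x)) ∧ (∀ a b : ℕ, a + 1 + b = 2 * q + 1 → a < q → Literature.Geometry.Kaehler.cechd 𝓘(ℝ, A.model) ℂ hU (a + 1) b (Z (a + 1) b) = Literature.Geometry.Kaehler.cechδ 𝓘(ℝ, A.model) ℂ hU a (b + 1) (Z a (b + 1))) ∧ (∀ (J : Fin 1 → ι), ∀ x ∈ Literature.Geometry.Kaehler.cechSet U J, ((Literature.Geometry.Kaehler.cechd 𝓘(ℝ, A.model) ℂ hU 0 (2 * q + 1) (Z 0 (2 * q + 1)) J : F (2 * q + 1 + 1)) x = θ x)); (∃ (ι : Type) (_ : Fintype ι) (U : ι → Set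 A.carrier) (hU : ∀ i, IsOpen (U i)) (_ : ∀ x, ∃ i, x ∈ U i) (σ : (Fin (q + 2) → ι) → (T →₀ ℤ)) (_ : ∀ J, ∀ t ∈ (σ J).support, Good (Literature.Geometry.Kaehler.cechSet U J) t) (_ : ∀ J' : Fin (q + 3) → ι, (∑ j : Fin (q + 3), ((-1 : ℤ) ^ (j : ℕ)) • σ (J' ∘ Fin.succAbove j)) ∈ Rel (Literature.Geometry.Kaehler.cechSet U J')) (θ : CF) (m : ℤ), Tr ι U hU (fun J ↦ SF (σ J)) θ ∧ DR (MK θ) = (m : ℂ) • A.pullback (2 * q + 1 + 1) c)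

/-- **`m ≠ 0` is load-bearing in (S): without it the symbol clause holds for EVERY class** (zero
cochain, `θ = 0`, `m = 0`), so the crux would collapse to (N) alone. [folklore] -/
theorem symbClauseAnyMultiple_trivial (A : HodgeModel n X) (q : ℕ) (c : complexBetti X (2 * (q + 1))) :
    SymbClauseAnyMultiple A q c := by
  dsimp only [SymbClauseAnyMultiple]
  refine ⟨Unit, inferInstance, fun _ ↦ Set.univ, fun _ ↦ isOpen_univ, fun x ↦ ⟨(), Set.mem_univ x⟩,
    fun _ ↦ 0, ?_, ?_, 0, 0, ⟨fun _ _ ↦ 0, ?_, ?_, ?_⟩, ?_⟩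
  · intro J t ht
    simp at ht
  · intro J'
    simp only [smul_zero, Finset.sum_const_zero]
    exact zero_mem _
  · intro J x _
    simp
  · intro a b _ _
    simp only [map_zero]
  · intro J x _
    simp
  · simp

/-- **SymbolLiftR ⟹ (N) is satisfiable on every smooth projective `X` in every weight `q + 1 ≤ n`**
(apply the crux to the rational `(q+1,q+1)` class `c = 0`). This is the cheapest remaining
falsifier: a smooth projective `X`, `q < dim X`, with NO Hodge model carrying a holomorphic line
bundle whose `dlog`-power cocycle transgresses to a non-zero rational class kills the crux.
[folklore] -/
theorem exists_normClause_of_symbolLiftR (h : SymbolLiftR) (hX : IsSmoothProjective n X) (q : ℕ)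
    (hq : q + 1 ≤ n) : ∃ A : HodgeModel n X, NormClause A q := by
  obtain ⟨A⟩ := nonempty_hodgeModel_holds hX
  obtain ⟨A', hN, -⟩ := h hX q hq 0 IsRationalClass.zero (IsOfHodgeType.zero A _ _ _)
  exact ⟨A', hN⟩

/-- **At `c = 0` the conclusion of the crux is EQUIVALENT to the satisfiability of (N).** [folklore] -/
theorem symbolLiftR_zero_iff_normClause (q : ℕ) :
    (∃ A : HodgeModel n X, NormClause A q ∧ SymbClause A q 0) ↔ ∃ A : HodgeModel n X, NormClause A q :=
  ⟨fun ⟨A, hN, _⟩ ↦ ⟨A, hN⟩, fun ⟨A, hN⟩ ↦ ⟨A, hN, symbClause_zero A q⟩⟩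

/-! ### §4 Load-bearing hypothesis `q + 1 ≤ n` (tight) -/

/-- **(N) forces a non-zero rational class in degree `2q + 2`**: in particular `H^{2q+2}(X(ℂ); ℂ) ≠ 0`.
This is the only content of (N) the tree can presently extract, and it is what the dimension bound
protects (below). [folklore] -/
theorem not_subsingleton_of_normClause {A : HodgeModel n X} {q : ℕ} (h : NormClause A q) :
    ¬ Subsingleton (complexBetti X (2 * q + 1 + 1)) := by
  obtain ⟨ι, _, L, θ₀, c₀, -, -, hc₀, -⟩ := h
  exact fun hs ↦ hc₀ (Subsingleton.elim _ _)


/-- `SymbolLiftR` with the dimension bound weakened by one, `q ≤ n` instead of `q + 1 ≤ n`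
(everything else verbatim). [folklore] -/
def SymbolLiftRWeakBound : Prop :=
  ∀ ⦃n : ℕ⦄ ⦃X : SchemeOver ℂ⦄, IsSmoothProjective n X → ∀ (q : ℕ), q ≤ n →
    ∀ (c : complexBetti X (2 * (q + 1))), IsRationalClass c →
      IsOfHodgeType n X (2 * (q + 1)) (q + 1) (q + 1) c →
        ∃ A : HodgeModel n X, NormClause A q ∧ SymbClause A q c

/-- The weakened statement implies the crux (so its refutation below is a TIGHTNESS result, not a
refutation of the crux). [folklore] -/
theorem symbolLiftR_of_weakBound (h : SymbolLiftRWeakBound) : SymbolLiftR :=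
  fun _n _X hX q hq c hc hpp ↦ h hX q (Nat.le_of_succ_le hq) c hc hpp

/-- **`q + 1 ≤ n` is load-bearing and tight: `¬ SymbolLiftRWeakBound`.** At `q = n` the
normalisation clause asks for a non-zero rational class `c₀ ∈ H^{2n+2}(X(ℂ); ℂ) = 0`
(`subsingleton_complexBetti`), while `c = 0` is a rational `(n+1,n+1)` class. Witness `X = ℙ⁰_ℂ`,
`n = q = 0`, `c = 0` (the witness of `MilnorKExponentialSymbolLift_refuted`, re-filed against the
live decl's clauses). Any proof of the crux must use `q + 1 ≤ n` exactly. [folklore] -/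
theorem symbolLiftR_false_without_dimBound : ¬ SymbolLiftRWeakBound := by
  intro h
  have hX : IsSmoothProjective 0 (projectiveSpace 0 ℂ) := isSmoothProjective_projectiveSpace_holds ℂ 0
  obtain ⟨A⟩ := nonempty_hodgeModel_holds hX
  obtain ⟨A', hN, -⟩ := h hX 0 le_rfl 0 IsRationalClass.zero (IsOfHodgeType.zero A _ _ _)
  exact not_subsingleton_of_normClause hN (subsingleton_complexBetti hX (by norm_num))


/-! ### §5 Why `(2πi)^{q+1}` is not an obstruction: Hodge models rescale -/

/-- **Rescaling the de Rham comparison of a Hodge model.** For `s ≠ 0`, the same analytification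
with the comparison family `s • A.deRham` (every degree, every manifold charted on `A.model`) is
again a Hodge model: naturality is `ℂ`-linear and the Hodge decomposition field does not mention the
comparison.  So the `∃ A` of the crux ranges over comparisons up to (at least) `ℂˣ`, and the factor
`(2πi)^{q+1}` by which `dlog`-transgressions miss `H^{2q+2}(X; ℚ)` under the integration comparison
is absorbed by the choice of `A`; the normalisation clause (N) is what pins the scalar, to
`(2πi)^{-(q+1)} ℚˣ`·(integration).  [folklore] -/
def rescale (A : HodgeModel n X) (s : ℂ) (hs : s ≠ 0) : HodgeModel n X where
  model := A.model
  carrier := A.carrier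
  toComplexPoints := A.toComplexPoints
  isAnalytification := A.isAnalytification
  deRham := fun M _ _ _ _ _ k ↦ (A.deRham M k).trans (LinearEquiv.smulOfNeZero ℂ _ s hs)
  deRham_isNatural := by
    intro M N _ _ _ _ _ _ _ _ _ _ _ f hf k c
    have h := A.deRham_isNatural M N f hf k c
    show s • A.deRham M k (Literature.NumberTheory.Transcendental.complexDeRhamCohomology.map A.model hf k c) =
      Literature.AlgebraicTopology.SingularHomology.singularCohomology.map ℂ ℂ ⟨f, hf.continuous⟩ k
        (s • A.deRham N k c)
    rw [h, map_smul]
  isInternal_hodgePQ := A.isInternal_hodgePQ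

/-- The rescaled comparison is `s •` the old one (definitional). [folklore] -/
theorem rescale_deRham_apply (A : HodgeModel n X) {s : ℂ} (hs : s ≠ 0) (k : ℕ)
    (x : Literature.NumberTheory.Transcendental.complexDeRhamCohomology A.model A.carrier k) :
    (rescale A s hs).deRham (rescale A s hs).carrier k x = s • A.deRham A.carrier k x :=
  rfl

/-- **(N) is stable under RATIONAL rescaling** (`c₀ ↦ r • c₀`): the normalisation pins the comparison
only up to `ℚˣ` — exactly the ambiguity that is harmless for `A.deRham [θ] = m • A^* c` with `c`
rational, `m ∈ ℤ ∖ {0}`.  (For irrational `s` the rescaled model fails (N) on paper — the set of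
transgression classes is countable — but the tree cannot prove it: near-miss §6.) [folklore] -/
theorem normClause_rescale (A : HodgeModel n X) (q : ℕ) (h : NormClause A q) (r : ℚ) (hr : r ≠ 0) :
    NormClause (rescale A r (by exact_mod_cast hr)) q := by
  dsimp only [NormClause] at h ⊢
  obtain ⟨ι, _, L, θ₀, c₀, hTr, hc₀, hne, hDR⟩ := h
  refine ⟨ι, inferInstance, L, θ₀, (r : ℂ) • c₀, hTr, hc₀.smul r, smul_ne_zero (by exact_mod_cast hr) hne, ?_⟩
  change (r : ℂ) • A.deRham A.carrier (2 * q + 1 + 1)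
      (Literature.NumberTheory.Transcendental.complexDeRhamCohomology.mk A.model A.carrier (2 * q + 1 + 1) θ₀) =
    A.pullback (2 * q + 1 + 1) ((r : ℂ) • c₀)
  rw [hDR, map_smul]

/-! ### §6 Near-misses (false on paper, not closable in the tree) -/

/-- `SymbolLiftR` with `IsRationalClass c` DROPPED. False on paper: on `ℙ¹`, `q = 0`, the class
`c = i • h` (`h = c₁(O(1))`) is of type `(1,1)` but `m • c` is never `A.deRham` of a `dlog`
transgression once (N) holds in `A` (transgression classes of weight-1 symbol cocycles are
`2πi · NS(X)` under integration, so `A.deRham`-classes of symbol cocycles are RATIONAL multiples of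
`c₀`).  OBSTRUCTION to a tree proof: (i) no computation `H²(ℙ¹(ℂ); ℂ) = ℂ · h`; (ii) no period
integrality for `dlog` transgressions (exponential sequence / Stokes); (iii) `A.deRham` is known only
up to natural automorphism.  Tried: the `ℙ⁰` junk model (no room: `q + 1 ≤ n` forces `n ≥ 1`);
`not_isRationalClass_I_smul_one` (degree `0` only). [folklore] -/
def SymbolLiftRWithoutRational : Prop :=
  ∀ ⦃n : ℕ⦄ ⦃X : SchemeOver ℂ⦄, IsSmoothProjective n X → ∀ (q : ℕ), q + 1 ≤ n →
    ∀ (c : complexBetti X (2 * (q + 1))),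
      IsOfHodgeType n X (2 * (q + 1)) (q + 1) (q + 1) c →
        ∃ A : HodgeModel n X, NormClause A q ∧ SymbClause A q c

/-- Near-miss: `¬ SymbolLiftRWithoutRational` (witness `ℙ¹`, `q = 0`, `c = i • c₁(O(1))`); see the
docstring of `SymbolLiftRWithoutRational` for the obstruction. [folklore] -/
theorem symbolLiftR_false_without_rational : ¬ SymbolLiftRWithoutRational := by
  sorry

/-- `SymbolLiftR` with `∀ A` for `∃ A` (both clauses in EVERY Hodge model). False on paper by §5:
if (N) holds in `A` it fails in `rescale A s` for `s ∉ ℚ · (periods)` (e.g. `s = π`), the set of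
`A.deRham`-classes of line-bundle transgressions being `ℚ c₀`-valued on `H^{2q+2}` of `ℙ^{q+1}`.
OBSTRUCTION: same as above plus irrationality of `π` against an uncomputed period lattice. [folklore] -/
def SymbolLiftRAllModels : Prop :=
  ∀ ⦃n : ℕ⦄ ⦃X : SchemeOver ℂ⦄, IsSmoothProjective n X → ∀ (q : ℕ), q + 1 ≤ n →
    ∀ (c : complexBetti X (2 * (q + 1))), IsRationalClass c →
      IsOfHodgeType n X (2 * (q + 1)) (q + 1) (q + 1) c →
        ∀ A : HodgeModel n X, NormClause A q ∧ SymbClause A q c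

/-- The `∀ A` variant implies the crux (Hodge models exist, `nonempty_hodgeModel_holds`). [folklore] -/
theorem symbolLiftR_of_allModels (h : SymbolLiftRAllModels) : SymbolLiftR := by
  intro n X hX q hq c hc hpp
  obtain ⟨A⟩ := nonempty_hodgeModel_holds hX
  exact ⟨A, h hX q hq c hc hpp A⟩

/-- Near-miss: `¬ SymbolLiftRAllModels` (witness `ℙ¹`, `q = 0`, `c = 0`, the model
`rescale A π`); obstruction in the docstring of `SymbolLiftRAllModels`. [folklore] -/
theorem symbolLiftR_false_allModels : ¬ SymbolLiftRAllModels := by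
  sorry

/-! ### §7 Line `lefschetz-fold`: the one open stub S5∃ (`stub_primitiveLiftExists`, reshape r2)

Gen-2 disprover (refuter-cdisprove-stmt-HodgeConjecture-18702-g2-0, 2026-08-17). The line's stubs
S1–S4 are landed Theorems and the reduction S5∃ ⇒ crux is landed (p156948); the ONLY open stub is
S5∃. Below: the stub verbatim (§7.0), joint sufficiency re-certified against it (§7.1), hypothesis
mutation (§7.2–§7.5: the two arithmetic guards are IDLE, `m ≠ 0` is load-bearing as non-vacuity only,
rationality / Hodge type are load-bearing on paper but not refutable in the tree), and the EXACT
surplus of the stub over the crux (§7.6: a model-transport statement, nothing mathematical). -/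

section LineLefschetzFold

open Literature.NumberTheory.Transcendental (complexDeRhamCohomology integrationDeRhamIsoFamily)

/-- **S5∃ verbatim** — the registered open stub `stub_primitiveLiftExists` of
`Cruxes/SymbolLiftR/Lines/lefschetz_fold.lean` (reshape r2; `IsIntegrationScaled` inlined): for `X`
smooth projective of dimension `n ≥ 4` there are a hard-Lefschetz datum `Λ` and a Hodge model `A`
whose comparison is the `(2πi)^{-k/2}`-rescaled integration comparison, on which every `Λ`-primitive
rational `(q+2,q+2)` class with `2(q+2) ≤ n` has a weight-`(q+2)` Milnor symbol cocycle. (A stub of the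
line, LOCAL copy for the analysis below — not a cited fact.) -/
def PrimitiveLiftExists : Prop :=
  ∀ ⦃n : ℕ⦄ ⦃X : SchemeOver ℂ⦄, IsSmoothProjective n X → 4 ≤ n →
    ∃ (Λ : HardLefschetzNFold n X) (A : HodgeModel n X),
      (∀ (k : ℕ) (y : complexDeRhamCohomology A.model A.carrier k),
        A.deRham A.carrier k y = ((2 * (Real.pi : ℂ) * Complex.I) ^ (k / 2))⁻¹ •
          (integrationDeRhamIsoFamily A.model).complexify A.carrier k y) ∧
      ∀ (q : ℕ), 2 * (q + 2) ≤ n →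
        ∀ (c : complexBetti X (2 * (q + 1 + 1))), IsRationalClass c →
          IsOfHodgeType n X (2 * (q + 1 + 1)) (q + 1 + 1) (q + 1 + 1) c →
          (∃ (j t : ℕ) (ht : 2 * (q + 1 + 1) + 2 * j = t),
              2 * (q + 1 + 1) + j = n + 1 ∧ Λ.L j (2 * (q + 1 + 1)) t ht c = 0) →
            A.HasSymbolCocycle (q + 1) c

/-- **§7.1 JOINT SUFFICIENCY is kernel-certified**: the stub set `{S5∃}` (with the landed S1–S4)
gives the crux BY NAME — this is the landed reduction
`Theorems.SymbolLiftR.symbolLiftR_of_primitiveLiftExists` (p156948) applied to the local copy; no gap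
is smuggled by the fold. [folklore] -/
theorem symbolLiftR_of_primitiveLiftExists (h : PrimitiveLiftExists) : SymbolLiftR :=
  _root_.Summit.HodgeConjecture.HodgeConjecture.Theorems.SymbolLiftR.symbolLiftR_of_primitiveLiftExists h

/-- S5∃ with the dimension guard `4 ≤ n` DROPPED (everything else verbatim). -/
def PrimitiveLiftExistsNoDimGuard : Prop :=
  ∀ ⦃n : ℕ⦄ ⦃X : SchemeOver ℂ⦄, IsSmoothProjective n X →
    ∃ (Λ : HardLefschetzNFold n X) (A : HodgeModel n X),
      (∀ (k : ℕ) (y : complexDeRhamCohomology A.model A.carrier k),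
        A.deRham A.carrier k y = ((2 * (Real.pi : ℂ) * Complex.I) ^ (k / 2))⁻¹ •
          (integrationDeRhamIsoFamily A.model).complexify A.carrier k y) ∧
      ∀ (q : ℕ), 2 * (q + 2) ≤ n →
        ∀ (c : complexBetti X (2 * (q + 1 + 1))), IsRationalClass c →
          IsOfHodgeType n X (2 * (q + 1 + 1)) (q + 1 + 1) (q + 1 + 1) c →
          (∃ (j t : ℕ) (ht : 2 * (q + 1 + 1) + 2 * j = t),
              2 * (q + 1 + 1) + j = n + 1 ∧ Λ.L j (2 * (q + 1 + 1)) t ht c = 0) →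
            A.HasSymbolCocycle (q + 1) c

/-- **§7.2 The guard `4 ≤ n` of S5∃ is IDLE**: dropping it gives an EQUIVALENT statement, because
for `n ≤ 3` the inner obligation is empty (`2(q+2) ≥ 4 > n`) and the `∃ Λ ∃ A` shell is a theorem of
the tree in every dimension (`nonempty_hardLefschetzNFold_holds`; any Hodge model rescaled to the
integration comparison, `Theorems.SymbolLiftR.exists_hodgeModel_integrationScaled`, which has no
dimension hypothesis). Information for the promoted item: the guard may be omitted. [folklore] -/
theorem primitiveLiftExistsNoDimGuard_iff : PrimitiveLiftExistsNoDimGuard ↔ PrimitiveLiftExists := by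
  refine ⟨fun h n X hX _ ↦ h hX, fun h n X hX ↦ ?_⟩
  by_cases h4 : 4 ≤ n
  · exact h hX h4
  · obtain ⟨Λ⟩ := nonempty_hardLefschetzNFold_holds n X hX
    obtain ⟨A₀⟩ := nonempty_hodgeModel_holds hX
    obtain ⟨A, hA⟩ :=
      _root_.Summit.HodgeConjecture.HodgeConjecture.Theorems.SymbolLiftR.exists_hodgeModel_integrationScaled A₀
    exact ⟨Λ, A, hA, fun q hq ↦ absurd hq (by omega)⟩

/-- S5∃ with the degree guard `2 * (q + 2) ≤ n` DROPPED (everything else verbatim). -/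
def PrimitiveLiftExistsNoDegreeGuard : Prop :=
  ∀ ⦃n : ℕ⦄ ⦃X : SchemeOver ℂ⦄, IsSmoothProjective n X → 4 ≤ n →
    ∃ (Λ : HardLefschetzNFold n X) (A : HodgeModel n X),
      (∀ (k : ℕ) (y : complexDeRhamCohomology A.model A.carrier k),
        A.deRham A.carrier k y = ((2 * (Real.pi : ℂ) * Complex.I) ^ (k / 2))⁻¹ •
          (integrationDeRhamIsoFamily A.model).complexify A.carrier k y) ∧
      ∀ (q : ℕ) (c : complexBetti X (2 * (q + 1 + 1))), IsRationalClass c →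
          IsOfHodgeType n X (2 * (q + 1 + 1)) (q + 1 + 1) (q + 1 + 1) c →
          (∃ (j t : ℕ) (ht : 2 * (q + 1 + 1) + 2 * j = t),
              2 * (q + 1 + 1) + j = n + 1 ∧ Λ.L j (2 * (q + 1 + 1)) t ht c = 0) →
            A.HasSymbolCocycle (q + 1) c

/-- **§7.3 The degree guard `2(q+2) ≤ n` of S5∃ is IDLE too**: the primitivity hypothesis guards
itself. If `2(q+2) > n` then either no `j` with `2(q+2) + j = n + 1` exists (hypothesis unsatisfiable)
or `2(q+2) = n + 1`, `j = 0`, and `L⁰ c = c = 0` (`lefschetzPowTo` at `j = 0` is the identity), which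
has the zero cocycle on every model (`HodgeModel.hasSymbolCocycle_zero`). Information for the promoted
item: the guard may be omitted (it only mirrors the fold's case split). [folklore] -/
theorem primitiveLiftExistsNoDegreeGuard_iff :
    PrimitiveLiftExistsNoDegreeGuard ↔ PrimitiveLiftExists := by
  refine ⟨fun h n X hX h4 ↦ ?_, fun h n X hX h4 ↦ ?_⟩
  · obtain ⟨Λ, A, hA, hS⟩ := h hX h4
    exact ⟨Λ, A, hA, fun q _ c hc hpp hprim ↦ hS q c hc hpp hprim⟩
  · obtain ⟨Λ, A, hA, hS⟩ := h hX h4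
    refine ⟨Λ, A, hA, fun q c hc hpp hprim ↦ ?_⟩
    by_cases hq : 2 * (q + 2) ≤ n
    · exact hS q hq c hc hpp hprim
    · obtain ⟨j, t, ht, hj, hL⟩ := hprim
      obtain rfl : j = 0 := by omega
      subst ht
      have hc0 : c = 0 := hL
      subst hc0
      exact A.hasSymbolCocycle_zero (q + 1)

/-- `A.HasSymbolCocycle q c` with the side condition `m ≠ 0` DROPPED (everything else verbatim: the
named-vocabulary twin of `SymbClauseAnyMultiple`). -/
def HasSymbolCocycleAnyMultiple (A : HodgeModel n X) (q : ℕ) (c : complexBetti X (2 * (q + 1))) : Prop :=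
  ∃ (ι : Type) (_ : Fintype ι) (U : ι → Set A.carrier) (hU : ∀ i, IsOpen (U i))
    (_ : ∀ x, ∃ i, x ∈ U i) (σ : (Fin (q + 2) → ι) → ((Fin (q + 1) → (A.carrier → ℂ)) →₀ ℤ))
    (_ : Literature.Geometry.Kaehler.IsMilnorSymbolCocycle A.model U σ)
    (θ : Literature.NumberTheory.Transcendental.cclosedSmoothForms A.model A.carrier (2 * q + 1 + 1)) (m : ℤ),
    Literature.Geometry.Kaehler.IsTransgression hU q
        (fun J ↦ Literature.Geometry.Kaehler.symbolForm A.model (q + 1) (σ J)) θ ∧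
      A.deRham A.carrier (2 * q + 1 + 1)
          (complexDeRhamCohomology.mk A.model A.carrier (2 * q + 1 + 1) θ) =
        (m : ℂ) • A.pullback (2 * q + 1 + 1) c

/-- **§7.4 `m ≠ 0` inside the stub's `HasSymbolCocycle` is load-bearing as NON-VACUITY**: with it
dropped every class on every model has a "symbol cocycle" (zero cochain, `θ = 0`, `m = 0`), so S5∃
would be a triviality. (On the integration-scaled model the VALUE of `m` is paper-idle in the stub's
weights `q + 2 ≥ 2` — `𝒦^M_{p,an}` is uniquely divisible for `p ≥ 2`, 2001 Lemma 7.1, so Čech classes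
divide after refinement — but NOT in weight one: `h/2` on `ℙ¹` has `m = 2` and no `m = 1` cocycle
there, `c₁` of line bundles being integral; neither refinement is provable in the tree today.)
[folklore] -/
theorem hasSymbolCocycleAnyMultiple_trivial (A : HodgeModel n X) (q : ℕ)
    (c : complexBetti X (2 * (q + 1))) : HasSymbolCocycleAnyMultiple A q c := by
  refine ⟨Unit, inferInstance, fun _ ↦ Set.univ, fun _ ↦ isOpen_univ, fun x ↦ ⟨(), Set.mem_univ x⟩,
    0, Literature.Geometry.Kaehler.isMilnorSymbolCocycle_zero _, 0, 0, ?_, ?_⟩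
  · refine ⟨fun _ _ ↦ 0, fun J x _ ↦ ?_, fun a b _ _ ↦ ?_, fun J x _ ↦ ?_⟩
    · simp only [map_zero, Pi.zero_apply, Literature.Geometry.Kaehler.symbolForm_zero,
        ZeroMemClass.coe_zero]
    · simp only [map_zero]
    · simp only [map_zero, Pi.zero_apply, ZeroMemClass.coe_zero]
  · simp only [map_zero, Int.cast_zero, zero_smul]

/-- S5∃ with `IsRationalClass c` DROPPED. FALSE on paper: on `ℙ² × ℙ²` (`n = 4`, `q = 0`) the
primitive part of `H⁴` is one-dimensional, spanned by a rational algebraic class `π`; `c = √2 • π` is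
primitive of type `(2,2)`, and a weight-2 symbol cocycle on the INTEGRATION-SCALED model would give
`m • c = A.deRham[θ] ∈ H⁴(X; ℚ)` (transgression classes of Milnor cocycles are `(2πi)^p`-rational:
the `dlog` map factors through Deligne–Beilinson cohomology `H^{2p}_𝒟(X, ℤ(p))`), forcing `√2 ∈ ℚ`.
OBSTRUCTION to a tree proof: the tree has the class ⇒ cocycle direction only
(`CechCocycleIntegral_holds`, `exists_isChernForm_of_cechIntegral`); integrality of the class of an
ARBITRARY holomorphic cocycle on an ARBITRARY finite cover (already for `p = 1`: `c₁(L) ∈ H²(X; ℤ)`)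
is absent, and so is `H⁴(ℙ² × ℙ²)`. [folklore] -/
def PrimitiveLiftExistsWithoutRational : Prop :=
  ∀ ⦃n : ℕ⦄ ⦃X : SchemeOver ℂ⦄, IsSmoothProjective n X → 4 ≤ n →
    ∃ (Λ : HardLefschetzNFold n X) (A : HodgeModel n X),
      (∀ (k : ℕ) (y : complexDeRhamCohomology A.model A.carrier k),
        A.deRham A.carrier k y = ((2 * (Real.pi : ℂ) * Complex.I) ^ (k / 2))⁻¹ •
          (integrationDeRhamIsoFamily A.model).complexify A.carrier k y) ∧
      ∀ (q : ℕ), 2 * (q + 2) ≤ n →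
        ∀ (c : complexBetti X (2 * (q + 1 + 1))),
          IsOfHodgeType n X (2 * (q + 1 + 1)) (q + 1 + 1) (q + 1 + 1) c →
          (∃ (j t : ℕ) (ht : 2 * (q + 1 + 1) + 2 * j = t),
              2 * (q + 1 + 1) + j = n + 1 ∧ Λ.L j (2 * (q + 1 + 1)) t ht c = 0) →
            A.HasSymbolCocycle (q + 1) c

/-- Near-miss: `¬ PrimitiveLiftExistsWithoutRational` (witness `ℙ² × ℙ²`, `q = 0`, `c = √2 • π`);
obstruction in the docstring of `PrimitiveLiftExistsWithoutRational`. [folklore] -/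
theorem primitiveLiftExists_false_without_rational : ¬ PrimitiveLiftExistsWithoutRational := by
  sorry

/-- S5∃ with `IsOfHodgeType … (q+2) (q+2) c` DROPPED. FALSE on paper: on an abelian fourfold
(`n = 4`, `q = 0`) the primitive rational lattice of `H⁴` has rank `b₄ − b₂ = 70 − 28 = 42` and is
Zariski-dense in the primitive real Hodge structure, whose `(4,0)` part is `H^{4,0} ≠ 0`; so some
primitive RATIONAL class has a non-zero `(4,0)`-component, while every class with a symbol cocycle on a
normalised model is of type `(2,2)` (transgressions of holomorphic `2`-forms lie in `F²H⁴`; this much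
IS the proved support item `SymbolClassesHodgeType`, given rationality). OBSTRUCTION to a tree proof:
no smooth projective `X` in the tree has a computed `h^{4,0} ≠ 0` (no abelian fourfold as a
`SchemeOver ℂ` with its Hodge numbers). [folklore] -/
def PrimitiveLiftExistsWithoutHodgeType : Prop :=
  ∀ ⦃n : ℕ⦄ ⦃X : SchemeOver ℂ⦄, IsSmoothProjective n X → 4 ≤ n →
    ∃ (Λ : HardLefschetzNFold n X) (A : HodgeModel n X),
      (∀ (k : ℕ) (y : complexDeRhamCohomology A.model A.carrier k),
        A.deRham A.carrier k y = ((2 * (Real.pi : ℂ) * Complex.I) ^ (k / 2))⁻¹ •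
          (integrationDeRhamIsoFamily A.model).complexify A.carrier k y) ∧
      ∀ (q : ℕ), 2 * (q + 2) ≤ n →
        ∀ (c : complexBetti X (2 * (q + 1 + 1))), IsRationalClass c →
          (∃ (j t : ℕ) (ht : 2 * (q + 1 + 1) + 2 * j = t),
              2 * (q + 1 + 1) + j = n + 1 ∧ Λ.L j (2 * (q + 1 + 1)) t ht c = 0) →
            A.HasSymbolCocycle (q + 1) c

/-- Near-miss: `¬ PrimitiveLiftExistsWithoutHodgeType` (witness: a primitive rational class with
non-zero `(4,0)`-component on an abelian fourfold); obstruction in the docstring of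
`PrimitiveLiftExistsWithoutHodgeType`. [folklore] -/
theorem primitiveLiftExists_false_without_hodgeType : ¬ PrimitiveLiftExistsWithoutHodgeType := by
  sorry

/-- **MODEL TRANSPORT** (a TYPING statement, true on paper, absent from the tree): a class carrying a
Milnor symbol cocycle on SOME symbol-normalised Hodge model carries one on EVERY integration-scaled
model. On paper: two analytifications are canonically biholomorphic; a natural comparison is a scalar
multiple of integration in each degree (`NaturalDeRhamComparisonRigidity_holds`); normalisation pins
that scalar to `(2πi)^{-(q+1)} ℚˣ` because the transgression class of the `dlog`-power cocycle of a line
bundle is `(2πi)^{q+1} c₁(L)^{q+1}`, rational; the rational factor is cleared by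
`HasSymbolCocycle.zsmul/of_zsmul`. The tree lacks the middle step (integrality of `c₁` of an ARBITRARY
cocycle) and the transport of covers / cocycles / zig-zags along a biholomorphism. [folklore] -/
def ModelTransport : Prop :=
  ∀ ⦃n : ℕ⦄ ⦃X : SchemeOver ℂ⦄, IsSmoothProjective n X →
    ∀ (q : ℕ) (c : complexBetti X (2 * (q + 1))),
      (∃ A : HodgeModel n X, A.IsSymbolNormalized q ∧ A.HasSymbolCocycle q c) →
        ∀ A : HodgeModel n X,
          (∀ (k : ℕ) (y : complexDeRhamCohomology A.model A.carrier k),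
            A.deRham A.carrier k y = ((2 * (Real.pi : ℂ) * Complex.I) ^ (k / 2))⁻¹ •
              (integrationDeRhamIsoFamily A.model).complexify A.carrier k y) →
            A.HasSymbolCocycle q c

/-- **§7.6 THE EXACT SURPLUS OF THE STUB OVER THE CRUX IS MODEL TRANSPORT**:
`ModelTransport → SymbolLiftR → PrimitiveLiftExists` (and `PrimitiveLiftExists → SymbolLiftR` is
§7.1). So S5∃ is the crux restricted to primitive classes PLUS the demand that ONE integration-scaled
model serve all of them — a typing surplus, not a mathematical one; the primitivity hypothesis is not
even used in this direction. A planner promoting S5∃ to an item inherits exactly this: either keep the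
one-model form (and owe transport to nobody, since the fold supplies the model) or state it per class
and owe `ModelTransport`. [folklore] -/
theorem primitiveLiftExists_of_symbolLiftR (hT : ModelTransport) (h : SymbolLiftR) :
    PrimitiveLiftExists := by
  intro n X hX _
  obtain ⟨Λ⟩ := nonempty_hardLefschetzNFold_holds n X hX
  obtain ⟨A₀⟩ := nonempty_hodgeModel_holds hX
  obtain ⟨A, hA⟩ :=
    _root_.Summit.HodgeConjecture.HodgeConjecture.Theorems.SymbolLiftR.exists_hodgeModel_integrationScaled A₀
  refine ⟨Λ, A, hA, fun q hq c hc hpp _ ↦ ?_⟩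
  obtain ⟨A', hN, hS⟩ := h hX (q + 1) (by omega) c hc hpp
  refine hT hX (q + 1) c ⟨A', ?_, ?_⟩ A hA
  · obtain ⟨ι, hι, L, θ₀, c₀, hTr, hr, hne, hde⟩ := hN
    exact ⟨ι, hι, L, θ₀, c₀, hTr, hr, hne, hde⟩
  · obtain ⟨ι, hι, U, hU, hcov, σ, hσ₁, hσ₂, θ, m, hm, hTr, hde⟩ := hS
    exact ⟨ι, hι, U, hU, hcov, σ, ⟨hσ₁, hσ₂⟩, θ, m, hm, hTr, hde⟩

end LineLefschetzFold

/-! ### §8 The multiplier `m` has no content at crux level: `m ≠ 0` can be normalised to `m = 1` -/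

/-- (S) with the multiplier FIXED to `m = 1` (everything else verbatim): `A.deRham [θ] = A^* c` on the
nose. -/
def SymbClauseOne (A : HodgeModel n X) (q : ℕ) (c : complexBetti X (2 * (q + 1))) : Prop :=
  let F : ℕ → Type := fun k ↦ Literature.Geometry.Kaehler.MForm 𝓘(ℝ, A.model) A.carrier ℂ k; let CF := Literature.NumberTheory.Transcendental.cclosedSmoothForms A.model A.carrier (2 * q + 1 + 1); let MK := Literature.NumberTheory.Transcendental.complexDeRhamCohomology.mk A.model A.carrier (2 * q + 1 + 1); let DR := A.deRham A.carrier (2 * q + 1 + 1); let T : Type := Fin (q + 1) → (A.carrier → ℂ); let IsU : Set A.carrier → (A.carrier → ℂ) → Prop := fun W f ↦ MDifferentiableOn 𝓘(ℂ, A.model) 𝓘(ℂ, ℂ) f W ∧ ∀ x ∈ W, f x ≠ 0; let Good : Set A.carrier → T → Prop := fun W t ↦ ∀ i, IsU W (t i); let Rel : Set A.carrier → AddSubgroup (T →₀ ℤ) := fun W ↦ AddSubgroup.closure ({s : T →₀ ℤ | ∃ t t' : T, Good W t ∧ Good W t' ∧ (∀ i, ∀ x ∈ W, t i x = t' i x)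 ∧ s = Finsupp.single t 1 - Finsupp.single t' 1} ∪ {s : T →₀ ℤ | ∃ (t : T) (i : Fin (q + 1)) (g : A.carrier → ℂ), Good W t ∧ IsU W g ∧ s = Finsupp.single (Function.update t i (t i * g)) 1 - Finsupp.single t 1 - Finsupp.single (Function.update t i g) 1} ∪ {s : T →₀ ℤ | ∃ (t : T) (i j : Fin (q + 1)), Good W t ∧ i ≠ j ∧ (∀ x ∈ W, t i x + t j x = 1) ∧ s = Finsupp.single t 1}); let DW : T → F (q + 1) := fun t ↦ Fin.hIterate (fun k : ℕ ↦ F k) (Literature.Geometry.Kaehler.MForm.ofFun 𝓘(ℝ, A.model) (fun _ : A.carrier ↦ (1 : ℂ))) (fun (i : Fin (q + 1)) (acc : F (i : ℕ)) ↦ Literature.Geometry.Kaehler.MForm.wedge acc (fun x : A.carrier ↦ (t i x)⁻¹ • Literature.Geometry.Kaehler.mextDeriv (Literature.Geometry.Kaehler.MForm.ofFun 𝓘(ℝ, A.model) (t i)) x)); let SF : (T →₀ ℤ) → F (q + 1) := fun σ ↦ Finsupp.sum σ fun (t : T) (z : ℤ) ↦ z • DW t; let Tr : (ι : Type) → (U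 : ι → Set A.carrier) → (∀ i, IsOpen (U i)) → ((Fin (q + 2) → ι) → F (q + 1)) → F (2 * q + 1 + 1) → Prop := fun ι U hU w θ ↦ ∃ Z : (a b : ℕ) → Literature.Geometry.Kaehler.CechForms 𝓘(ℝ, A.model) ℂ U a b, (∀ (J : Fin (q + 2) → ι), ∀ x ∈ Literature.Geometry.Kaehler.cechSet U J, ((Literature.Geometry.Kaehler.cechδ 𝓘(ℝ, A.model) ℂ hU q (q + 1) (Z q (q + 1)) J : F (q + 1)) x = w J x)) ∧ (∀ a b : ℕ, a + 1 + b = 2 * q + 1 → a < q → Literature.Geometry.Kaehler.cechd 𝓘(ℝ, A.model) ℂ hU (a + 1) b (Z (a + 1) b) = Literature.Geometry.Kaehler.cechδ 𝓘(ℝ, A.model) ℂ hU a (b + 1) (Z a (b + 1))) ∧ (∀ (J : Fin 1 → ι), ∀ x ∈ Literature.Geometry.Kaehler.cechSet U J, ((Literature.Geometry.Kaehler.cechd 𝓘(ℝ, A.model) ℂ hU 0 (2 * q + 1) (Z 0 (2 * q + 1)) J : F (2 * q + 1 + 1)) x = θ x)); (∃ (ι : Type) (_ : Fintype ι) (U :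 ι → Set A.carrier) (hU : ∀ i, IsOpen (U i)) (_ : ∀ x, ∃ i, x ∈ U i) (σ : (Fin (q + 2) → ι) → (T →₀ ℤ)) (_ : ∀ J, ∀ t ∈ (σ J).support, Good (Literature.Geometry.Kaehler.cechSet U J) t) (_ : ∀ J' : Fin (q + 3) → ι, (∑ j : Fin (q + 3), ((-1 : ℤ) ^ (j : ℕ)) • σ (J' ∘ Fin.succAbove j)) ∈ Rel (Literature.Geometry.Kaehler.cechSet U J')) (θ : CF), Tr ι U hU (fun J ↦ SF (σ J)) θ ∧ DR (MK θ) = A.pullback (2 * q + 1 + 1) c)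

/-- `m = 1` is a special case of `m ≠ 0`. [folklore] -/
theorem symbClause_of_symbClauseOne (A : HodgeModel n X) (q : ℕ) (c : complexBetti X (2 * (q + 1)))
    (h : SymbClauseOne A q c) : SymbClause A q c := by
  dsimp only [SymbClauseOne] at h
  dsimp only [SymbClause]
  obtain ⟨ι, hι, U, hU, hcov, σ, hσ₁, hσ₂, θ, hTr, hDR⟩ := h
  refine ⟨ι, hι, U, hU, hcov, σ, hσ₁, hσ₂, θ, 1, one_ne_zero, hTr, ?_⟩
  rw [hDR, Int.cast_one, one_smul]

/-- **Rescaling the model by `m⁻¹` turns (S) with multiplier `m ≠ 0` into (S) with `m = 1`** — same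
cover, same Milnor cocycle, same zig-zag and form; only the comparison changes, by the RATIONAL factor
`m⁻¹` (so (N) survives, `normClause_rescale`). [folklore] -/
theorem symbClauseOne_rescale (A : HodgeModel n X) (q : ℕ) (c : complexBetti X (2 * (q + 1)))
    (h : SymbClause A q c) :
    ∃ (r : ℚ) (hr : r ≠ 0), SymbClauseOne (rescale A r (by exact_mod_cast hr)) q c := by
  dsimp only [SymbClause] at h
  obtain ⟨ι, hι, U, hU, hcov, σ, hσ₁, hσ₂, θ, m, hm, hTr, hDR⟩ := h
  refine ⟨(m : ℚ)⁻¹, inv_ne_zero (by exact_mod_cast hm), ?_⟩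
  dsimp only [SymbClauseOne]
  refine ⟨ι, hι, U, hU, hcov, σ, hσ₁, hσ₂, θ, hTr, ?_⟩
  change (((m : ℚ)⁻¹ : ℚ) : ℂ) • A.deRham A.carrier (2 * q + 1 + 1)
      (Literature.NumberTheory.Transcendental.complexDeRhamCohomology.mk A.model A.carrier (2 * q + 1 + 1) θ) =
    A.pullback (2 * q + 1 + 1) c
  rw [hDR, smul_smul]
  push_cast
  rw [inv_mul_cancel₀ (by exact_mod_cast hm), one_smul]

/-- `SymbolLiftR` with the multiplier of the symbol clause FIXED to `m = 1` ("`A^* c` itself is the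
de Rham class of a Milnor-symbol transgression on a normalised model"). -/
def SymbolLiftROne : Prop :=
  ∀ ⦃n : ℕ⦄ ⦃X : SchemeOver ℂ⦄, IsSmoothProjective n X → ∀ (q : ℕ), q + 1 ≤ n →
    ∀ (c : complexBetti X (2 * (q + 1))), IsRationalClass c →
      IsOfHodgeType n X (2 * (q + 1)) (q + 1) (q + 1) c →
        ∃ A : HodgeModel n X, NormClause A q ∧ SymbClauseOne A q c

/-- **The crux is EQUIVALENT to its `m = 1` form**: `SymbolLiftR ↔ SymbolLiftROne`. With §3b
(`m ≠ 0` dropped ⇒ (S) trivial) this pins the exact role of the multiplier: only `m ≠ 0` versus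
`m = 0` matters; its VALUE is absorbed by the `∃ A` (rescale by `m⁻¹ ∈ ℚˣ`, which (N) tolerates).
Hence the crux has no integral content whatsoever — consistent with `𝒦^M_{p,an}` being a `ℚ`-sheaf for
`p ≥ 2` (2001 Lemma 7.1) and with the Atiyah–Hirzebruch / Kollár barriers being evaded by design; an
attack through INTEGRAL classes (torsion, non-divisible classes) cannot touch it. On a FIXED
integration-scaled model (the line's S5∃) the value of `m` does matter in weight one (`h/2` on `ℙ¹`).
[folklore] -/
theorem symbolLiftR_iff_symbolLiftROne : SymbolLiftR ↔ SymbolLiftROne := by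
  constructor
  · intro h n X hX q hq c hc hpp
    obtain ⟨A, hN, hS⟩ := h hX q hq c hc hpp
    obtain ⟨r, hr, hS₁⟩ := symbClauseOne_rescale A q c hS
    exact ⟨_, normClause_rescale A q hN r hr, hS₁⟩
  · intro h n X hX q hq c hc hpp
    obtain ⟨A, hN, hS₁⟩ := h hX q hq c hc hpp
    exact ⟨A, hN, symbClause_of_symbClauseOne A q c hS₁⟩


end Summit.HodgeConjecture.HodgeConjecture.Cruxes.SymbolLiftR.Disproof

end
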